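import Summits.BirchSwinnertonDyer.BirchSwinnertonDyer.Theorems.EisensteinPrimesMazurMCOnCellBTwistbackKLFlatPartner
import Summits.BirchSwinnertonDyer.BirchSwinnertonDyer.Theorems.EisensteinPrimesMazurMCOnCellBTwistbackPartnerTrivialZero
import HarnessLib

/-!
# Crux 3 `MazurMCOnCellB` (stmt-BirchSwinnertonDyer-19033), line `twistback` v4 — KERNEL F1, part D: the KL-flat partner
# door with its two Bernoulli hypotheses MERGED into ONE unit `B₁^{(d)}(ω̃ ∘ ψ⁻¹)` (width seat w3 g6's unit criteria
# p643262) — for the curve `φω⁻¹ = ψ⁻¹`, so `L_∅(C,0)` and `L_∅(D,0)` are units together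

LEAD bsd-line-x2-p1 g10 (2026-08-28). HONEST FRAMING (cell `bsd-eis`): conditional theorems only; inputs BY NAME as in
part C (`PublishedInputs`, Disegni Thm. 4(1), GV Thm. (3.11)) plus PER PAIR: STEP L, ONE admissible `K`, and a carrier's line
datum with (i) the Weil-pairing relation `φ(a)·a⁻¹ = ψ⁻¹(a)` off `pℕ` (hypothesis `hφψ`; for a curve `φψ = ω`, GV p. 28),
(ii) `ψ(p) ≠ 1` (no trivial zero; automatic at a NON-split pair where `ψ(p) = −1`), (iii) ONE unit: `‖B₁^{(d)}(ω̃∘ψ⁻¹)‖_p = 1`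
(= `p ∤ h(−d)` for quadratic `ψ` of conductor `d > 4`: w3 g7 `…TwistbackPartnerClassNumber`), (iv) local balance `1`. No
`p`-adic `L`-function, height or Schneider hypothesis. Nothing booked; no MC / BSD proved for any curve unconditionally;
0 cells / labels / tiers move.

* §1 `klFlat_of_norm_twistedBernoulli_eq_one` — (i)+(ii)+(iii) ⟹ `‖L_∅(C,0)‖ = ‖L_∅(D,0)‖ = 1` (w3 g6's
  `norm_characterLValueC/D_one_eq_one` at `Σ₀ = ∅`, `χ := ψ⁻¹`).
* §2 `missingUpperBoundAt_of_cellC_of_not_split_of_bernoulliUnit_isogenous` — part C §1 with (i)–(iii) in place of KL-flat.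
* §3 `mazurMainConjectureAt_of_cellB_of_not_split_of_indexLowerBoundAt_of_bernoulliUnit_twist` — part C §2 likewise: PER PAIR,
  NON-split X2b, Mazur's MC ⟸ STEP L at one Heegner datum + ONE admissible `K` (`r_an = 1` at the twist) + a carrier isogenous to
  the twist with a ramified-even line, (i), (ii), ONE Bernoulli unit, balance `1`.

References: [GreenbergVatsal2000] §2 p. 28, §3 Thm. (3.11), (26)–(28); [Washington1997] Thm. 4.17, Thm. 5.11; [LangCyclotomic1990]
Ch. 4 §3 Thm. 3.2; [Wuthrich2014] Thm. 16; [Disegni2020] Thm. 4; [MilneADT2006] I.7.3.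
-/

set_option autoImplicit false

-- `Summit.BirchSwinnertonDyer.BirchSwinnertonDyer.…`: the summit and its single sub-problem share a name.
set_option linter.dupNamespace false

noncomputable section

open scoped Classical MatrixGroups ModularForm

open CongruenceSubgroup WeierstrassCurve NumberField IsDedekindDomain Field PowerSeries
  Literature.NumberTheory.EllipticCurves
  Literature.NumberTheory.GaloisRepresentations
  Literature.NumberTheory.EllipticCurves.ModularForms
  Literature.NumberTheory.QuadraticFields
  Literature.NumberTheory.EllipticCurves.Rank1Residual
  Literature.NumberTheory.EllipticCurves.Rank1Residual.Typed
  Literature.NumberTheory.EllipticCurves.GreenbergVatsal2000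
  Literature.NumberTheory.EllipticCurves.Disegni2020
  Summit.BirchSwinnertonDyer.Rank1Residual
  Summit.BirchSwinnertonDyer.BirchSwinnertonDyer.Theses
  Summit.BirchSwinnertonDyer.BirchSwinnertonDyer.Theorems.EisensteinPrimesMazurMCOnCellBTwistbackPartnerTrivialZero
  Summit.BirchSwinnertonDyer.BirchSwinnertonDyer.Theorems.EisensteinPrimesMazurMCOnCellBTwistbackKLFlatPartner

namespace Summit.BirchSwinnertonDyer.BirchSwinnertonDyer.Theorems.EisensteinPrimesMazurMCOnCellBTwistbackKLFlatPartnerUnits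

/-! ## §1. One Bernoulli unit gives both KL-flat hypotheses -/

/-- **ONE unit ⟹ KL-flat on both sides**: for `p ≠ 2`, `φ` mod `m ≥ 1`, `ψ` mod `d ≥ 1` with the Weil-pairing relation
`φ(a)·a⁻¹ = ψ⁻¹(a)` for `p ∤ a` (GV p. 28: `φψ = ω`), `ψ(p) ≠ 1` (no trivial zero of `L_p(ωψ⁻¹, s)` at `s = 0`), and
`‖B₁^{(d)}(ω̃ ∘ ψ⁻¹)‖_p = 1`: both `‖L_∅(C, 0)‖_p = 1` and `‖L_∅(D, 0)‖_p = 1` (`characterLValueC p φ ∅ 1`,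
`characterLValueD p ψ ∅ 1`) — w3 g6's unit criteria at `Σ₀ = ∅` with `χ := ψ⁻¹`. [cite: GreenbergVatsal2000, §2 p. 28 (φψ = ω) and §3 pp. 41–42 ((26), (27))]
[cite: Washington1997, Thm. 5.11 (the factor 1 − χω⁻¹(p))] [cite: LangCyclotomic1990, Ch. 4 §3 Thm. 3.2] -/
theorem klFlat_of_norm_twistedBernoulli_eq_one (p : ℕ) [Fact p.Prime] {m d : ℕ} [NeZero m] [NeZero d]
    (φ : DirichletCharacter (ZMod p) m) (ψ : DirichletCharacter (ZMod p) d) (hp2 : p ≠ 2)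
    (hφψ : ∀ a : ℕ, ¬ p ∣ a → φ (a : ZMod m) * (a : ZMod p)⁻¹ = ψ⁻¹ (a : ZMod d))
    (hψp : ψ (p : ZMod d) ≠ 1)
    (hB : ‖twistedBernoulli p 1 d (fun a : ℕ ↦ teichmullerLift p (ψ (a : ZMod d))⁻¹)‖ = 1) :
    ‖characterLValueC p φ ∅ 1‖ = 1 ∧ ‖characterLValueD p ψ ∅ 1‖ = 1 := by
  have hm : 0 < m := Nat.pos_of_ne_zero (NeZero.ne m)
  have hinv : ∀ a : ℕ, ψ⁻¹ (a : ZMod d) = (ψ (a : ZMod d))⁻¹ := fun a ↦ MulChar.inv_apply_eq_inv' ψ _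
  have hψp' : ψ⁻¹ (p : ZMod d) ≠ 1 := by
    rw [hinv]; exact inv_ne_one.mpr hψp
  have hB' : ‖twistedBernoulli p 1 d (fun a : ℕ ↦ teichmullerLift p (ψ⁻¹ (a : ZMod d)))‖ = 1 := by
    have : (fun a : ℕ ↦ teichmullerLift p (ψ⁻¹ (a : ZMod d))) =
        fun a : ℕ ↦ teichmullerLift p (ψ (a : ZMod d))⁻¹ := funext fun a ↦ by rw [hinv]
    rw [this]; exact hB
  exact ⟨norm_characterLValueC_one_eq_one p φ ∅ ψ⁻¹ hm hφψ hψp' (by simp) hB',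
    norm_characterLValueD_one_eq_one p ψ ∅ hp2 hψp (by simp) hB⟩

/-! ## §2. PER PARTNER: the upper half from ONE Bernoulli unit on an isogenous carrier -/

/-- **PER PARTNER, NON-SPLIT: `BSD(V, ℓ)` and its upper half from a ramified-even line datum on an isogenous carrier with
ONE Bernoulli unit** — part C §1 (`missingUpperBoundAt_of_cellC_of_not_split_of_klFlat_isogenous`) with its two KL-flat
hypotheses supplied by §1 from `φ(a)a⁻¹ = ψ⁻¹(a)`, `ψ(ℓ) ≠ 1`, `‖B₁^{(d)}(ω̃∘ψ⁻¹)‖_ℓ = 1`.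
[cite: GreenbergVatsal2000, §3 Thm. (3.11) (p. 43) with (26)–(28) and §2 p. 28] [cite: Wuthrich2014, Thm. 16 (p. 397)]
[cite: Disegni2020, Thm. 4 (§3.2)] [cite: MilneADT2006, Thm. I.7.3 and Remark I.7.4] -/
theorem missingUpperBoundAt_of_cellC_of_not_split_of_bernoulliUnit_isogenous (hP : EisensteinPrimes.PublishedInputs)
    (hDis : padicBSD_rankOne_nonsplitMult) (h311 : thm311_hasUnitContent_iff_and_order_eq_of_lineRamifiedEven)
    (V : WeierstrassCurve ℚ) [V.IsElliptic] [V.IsGloballyMinimal] (ℓ : ℕ) [Fact ℓ.Prime]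
    (hcV : X2.CellC V ℓ) (hns : ¬ V.HasSplitMultiplicativeReductionAtPrime ℓ)
    (V' : WeierstrassCurve ℚ) [V'.IsElliptic] [V'.IsGloballyMinimal] (hiso : IsIsogenous V V')
    (S₀ : Finset (HeightOneSpectrum (𝓞 ℚ))) (Φ₀ : AddSubgroup (V'.geomTorsion (ℓ : ℤ)))
    (m : ℕ) [NeZero m] (φ : DirichletCharacter (ZMod ℓ) m)
    (d : ℕ) [NeZero d] (ψ : DirichletCharacter (ZMod ℓ) d)
    (hΦ : IsRationalLine V' ℓ Φ₀) (hram : ¬ LineUnramifiedAt V' ℓ Φ₀) (heven : LineEven V' ℓ Φ₀)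
    (hφ : φ.IsPrimitive) (hψ : ψ.IsPrimitive) (hℓm : ℓ ∣ m) (hℓd : ¬ ℓ ∣ d)
    (hφ0 : ∀ (σ : absoluteGaloisGroup ℚ), ∀ P ∈ Φ₀,
      σ • P = (φ ((modNCyclotomicCharacter ℚ m σ : (ZMod m)ˣ) : ZMod m)).val • P)
    (hψ0 : ∀ (σ : absoluteGaloisGroup ℚ) (P : V'.geomTorsion (ℓ : ℤ)),
      σ • P - (ψ ((modNCyclotomicCharacter ℚ d σ : (ZMod d)ˣ) : ZMod d)).val • P ∈ Φ₀)
    (hS₀p : ∀ v ∈ S₀, ((ℓ : ℕ) : 𝓞 ℚ) ∉ v.asIdeal)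
    (hS : ∀ v : HeightOneSpectrum (𝓞 ℚ), v ∉ S₀ → ((ℓ : ℕ) : 𝓞 ℚ) ∉ v.asIdeal → V'.HasGoodReductionAt v)
    (hφψ : ∀ a : ℕ, ¬ ℓ ∣ a → φ (a : ZMod m) * (a : ZMod ℓ)⁻¹ = ψ⁻¹ (a : ZMod d))
    (hψℓ : ψ (ℓ : ZMod d) ≠ 1)
    (hB : ‖twistedBernoulli ℓ 1 d (fun a : ℕ ↦ teichmullerLift ℓ (ψ (a : ZMod d))⁻¹)‖ = 1)
    (hbal : 1 + ∑ v ∈ S₀, delta V' ℓ v =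
      ∑ v ∈ S₀, ((if φ (Rat.HeightOneSpectrum.natGenerator v : ZMod m) =
            (Rat.HeightOneSpectrum.natGenerator v : ZMod ℓ)
          then sFactor ℓ (Rat.HeightOneSpectrum.natGenerator v) else 0) +
        (if ψ (Rat.HeightOneSpectrum.natGenerator v : ZMod d) =
            (Rat.HeightOneSpectrum.natGenerator v : ZMod ℓ)
          then sFactor ℓ (Rat.HeightOneSpectrum.natGenerator v) else 0))) :
    BSDp V ℓ ∧ MissingUpperBoundAt V ℓ := by
  obtain ⟨hC1, hD1⟩ := klFlat_of_norm_twistedBernoulli_eq_one ℓ φ ψ hcV.2.1 hφψ hψℓ hB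
  exact missingUpperBoundAt_of_cellC_of_not_split_of_klFlat_isogenous hP hDis h311 V ℓ hcV hns V' hiso S₀ Φ₀ m φ d ψ
    hΦ hram heven hφ hψ hℓm hℓd hφ0 hψ0 hS₀p hS hC1 hD1 hbal

/-! ## §3. PER PAIR, NON-SPLIT X2b: Mazur's MC from STEP L, ONE admissible `K`, ONE Bernoulli unit -/

/-- **PER PAIR, NON-SPLIT: Mazur's main conjecture at an X2b pair `(W, p)` from STEP L over `K` at ONE Heegner datum with
`p ∤ c`, ONE admissible `K` with `ord_{s=1} L(E^{(d_K)}, s) = 1`, and a carrier `V′` `ℚ`-isogenous to the twist `Wd`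
carrying a ramified-even rational line with primitive characters `φ`, `ψ` (`φ(a)a⁻¹ = ψ⁻¹(a)`, `ψ(p) ≠ 1`), ONE unit
`‖B₁^{(d)}(ω̃∘ψ⁻¹)‖_p = 1` and local balance `1`** — part C §2 with KL-flat supplied by §1. For quadratic `ψ` of conductor
`d > 4` the unit is `p ∤ h(−d)` (w3 g7). BSD / MC proved for no curve unconditionally. [cite: JetchevSkinnerWan2017, §7.4.1]
[cite: GreenbergVatsal2000, §3 Thm. (3.11) (p. 43) and §2 p. 28] [cite: Washington1997, Thm. 4.17 and Thm. 5.11]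
[cite: Disegni2020, Thm. 4 (§3.2)] [cite: Wuthrich2014, Thm. 16 (p. 397)] -/
theorem mazurMainConjectureAt_of_cellB_of_not_split_of_indexLowerBoundAt_of_bernoulliUnit_twist
    (hP : EisensteinPrimes.PublishedInputs) (hDis : padicBSD_rankOne_nonsplitMult)
    (h311 : thm311_hasUnitContent_iff_and_order_eq_of_lineRamifiedEven)
    (W : WeierstrassCurve ℚ) [W.IsElliptic] [W.IsGloballyMinimal] (p : ℕ) [Fact p.Prime]
    (hc : X2.CellB W p) (hns : ¬ W.HasSplitMultiplicativeReductionAtPrime p)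
    (N : ℕ) [NeZero N] (K : Type) [Field K] [NumberField K]
    (Dt : ModularParametrizationData W N) (H : HeegnerDatum N (NumberField.discr K)) (ι : K →+* ℂ)
    (P : (W.baseChange K).toAffine.Point)
    (hK : IsImaginaryQuadratic K) (hodd : Odd (NumberField.discr K)) (hlt : NumberField.discr K < -4)
    (hN : W.conductorNorm ℤ = N) (hHN : SatisfiesHeegnerHypothesis N K)
    (hHp : SatisfiesHeegnerHypothesis p K)
    (hPt : WeierstrassCurve.Affine.Point.map ι.toRatAlgHom P = heegnerPointComplex Dt H)
    (hcM : ¬ (p : ℤ) ∣ Dt.c)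
    (Wd : WeierstrassCurve ℚ) [Wd.IsElliptic] [Wd.IsGloballyMinimal]
    (hWd : ∃ C : VariableChange ℚ, C • Wd = W.quadraticTwist (NumberField.discr K : ℚ))
    (hrd : Wd.analyticRank = 1)
    (hlow : Finite (W.baseChange K).sha → X11b.IndexLowerBoundAt W p K P)
    (V' : WeierstrassCurve ℚ) [V'.IsElliptic] [V'.IsGloballyMinimal] (hiso : IsIsogenous Wd V')
    (S₀ : Finset (HeightOneSpectrum (𝓞 ℚ))) (Φ₀ : AddSubgroup (V'.geomTorsion (p : ℤ)))
    (m : ℕ) [NeZero m] (φ : DirichletCharacter (ZMod p) m)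
    (d : ℕ) [NeZero d] (ψ : DirichletCharacter (ZMod p) d)
    (hΦ : IsRationalLine V' p Φ₀) (hram : ¬ LineUnramifiedAt V' p Φ₀) (heven : LineEven V' p Φ₀)
    (hφ : φ.IsPrimitive) (hψ : ψ.IsPrimitive) (hpm : p ∣ m) (hpd : ¬ p ∣ d)
    (hφ0 : ∀ (σ : absoluteGaloisGroup ℚ), ∀ Q ∈ Φ₀,
      σ • Q = (φ ((modNCyclotomicCharacter ℚ m σ : (ZMod m)ˣ) : ZMod m)).val • Q)
    (hψ0 : ∀ (σ : absoluteGaloisGroup ℚ) (Q : V'.geomTorsion (p : ℤ)),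
      σ • Q - (ψ ((modNCyclotomicCharacter ℚ d σ : (ZMod d)ˣ) : ZMod d)).val • Q ∈ Φ₀)
    (hS₀p : ∀ v ∈ S₀, ((p : ℕ) : 𝓞 ℚ) ∉ v.asIdeal)
    (hS : ∀ v : HeightOneSpectrum (𝓞 ℚ), v ∉ S₀ → ((p : ℕ) : 𝓞 ℚ) ∉ v.asIdeal → V'.HasGoodReductionAt v)
    (hφψ : ∀ a : ℕ, ¬ p ∣ a → φ (a : ZMod m) * (a : ZMod p)⁻¹ = ψ⁻¹ (a : ZMod d))
    (hψp : ψ (p : ZMod d) ≠ 1)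
    (hB : ‖twistedBernoulli p 1 d (fun a : ℕ ↦ teichmullerLift p (ψ (a : ZMod d))⁻¹)‖ = 1)
    (hbal : 1 + ∑ v ∈ S₀, delta V' p v =
      ∑ v ∈ S₀, ((if φ (Rat.HeightOneSpectrum.natGenerator v : ZMod m) =
            (Rat.HeightOneSpectrum.natGenerator v : ZMod p)
          then sFactor p (Rat.HeightOneSpectrum.natGenerator v) else 0) +
        (if ψ (Rat.HeightOneSpectrum.natGenerator v : ZMod d) =
            (Rat.HeightOneSpectrum.natGenerator v : ZMod p)
          then sFactor p (Rat.HeightOneSpectrum.natGenerator v) else 0))) :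
    X2.MazurMainConjectureAt W p := by
  obtain ⟨hC1, hD1⟩ := klFlat_of_norm_twistedBernoulli_eq_one p φ ψ hc.2.1.1 hφψ hψp hB
  exact mazurMainConjectureAt_of_cellB_of_not_split_of_indexLowerBoundAt_of_klFlat_twist hP hDis h311 W p hc hns N K Dt H
    ι P hK hodd hlt hN hHN hHp hPt hcM Wd hWd hrd hlow V' hiso S₀ Φ₀ m φ d ψ hΦ hram heven hφ hψ hpm hpd hφ0 hψ0 hS₀p hS
    hC1 hD1 hbal

end Summit.BirchSwinnertonDyer.BirchSwinnertonDyer.Theorems.EisensteinPrimesMazurMCOnCellBTwistbackKLFlatPartnerUnits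

end
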